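import Literature.AlgebraicGeometry.Resolution.RegularCentreBlowupOrder
import Literature.AlgebraicGeometry.Resolution.StrictTransformDistinct
import HarnessLib

/-!
# Hypersurfaces of maximal multiplicity: the strict transform is the weak transform with the maximal exponent, and stays a hypersurface (Kollár 2007, 3.58/3.60; CoP1 Prop. 4.2)

Topic: `Literature/AlgebraicGeometry/Resolution`. The classical bookkeeping behind resolution of
embedded HYPERSURFACES by blowing up smooth centres inside the locus of maximal multiplicity
(Hironaka 1964 Ch. III; J. Kollár, *Lectures on Resolution of Singularities* (2007), 3.58–3.60
"birational transform of hypersurfaces … if `mult_Z X = m` then `π^* X = m E + X'` with `X'` the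
birational (strict) transform"; Cossart–Piltant, J. Algebra 320 (2008), proof of Prop. 4.2, (10)–(11)):

Let `π : X' → X` be the blowing up of a regular locally Noetherian scheme `X` along a regular
centre `Y`, `J` an ideal sheaf whose order is `μ` at every point of `Y`, and suppose the stalk
`J_x`, `x = π x' ∈ Y`, is PRINCIPAL, `J_x = (g)` (a hypersurface). Then, with `e` a local equation
of the exceptional divisor at `x'`:

* `IsBlowup.exists_stalkIdeal_map_eq_span_pow_mul` — **`g𝒪_{X',x'} = (e^μ · g')` with `e` a PRIME
  nonzerodivisor of `𝒪_{X',x'}` not dividing `g'`** (chart computation: `g = F(c)` for a form `F` of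
  degree `μ` in quasi-regular generators `c` of `𝓘_{Y,x}` with `F̄ ≠ 0` modulo `𝔪_x`, hence modulo
  `(c)`; on the chart `B_j = 𝒪_{X,x}[(c)/c_j]` one has `φ(g) = φ(c_j)^μ F(e)` with `F(e) ∉ (φ c_j)`,
  a prime ideal since `𝒪_{X,x}/(c) = 𝒪_{Y,x}` is a domain — tree `PermissibleBlowup.lean`,
  `RegularCentreBlowupOrder.lean`, `BlowupStalkCharts.lean`);
* `IsBlowup.stalkIdeal_transforms_eq_span_of_isPrincipal` — **both the weak (controlled) transform
  `(J𝒪_{X'} : 𝓘_E^μ)` and the scheme-theoretic strict transform `⋃ₙ (J𝒪_{X'} : 𝓘_E^n)` have stalk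
  `(g')` at `x'`**; hence
* `IsBlowup.strictTransformIdeal_eq_controlledTransform_of_forall_isPrincipal` — **for a hypersurface
  `J` (all stalks principal) of order `μ` along the regular centre, strict transform = weak transform
  with exponent `μ`**, and `IsBlowup.isPrincipal_stalkIdeal_controlledTransform` — **the transform is
  again a hypersurface** (all stalks principal).
* `isPrincipal_stalkIdeal_of_isEffectiveCartier` — the stalks of an effective Cartier divisor are
  principal (public form of the hypothesis `hJ` below);
* `IsBlowup.comap_eq_pow_mul_strictTransformIdeal_of_forall_isPrincipal` — the two combined:
  **`J𝒪_{X'} = 𝓘_E^μ · (strict transform)`**, Kollár's `π^* X = m E + X'` (3.60) for ideal sheaves.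

Pure algebra (private plumbing): `(e^μ g : e^n) ⊆ (g)` when `e` is a nonzerodivisor with
`e ∣ g t ⇒ e ∣ t`. Consumed by the campaign cell `res-hironaka` (LADDER-RESOLUTION) for the
hypersurface case of the §1 «ERS» reading of H. Hironaka's 2017 manuscript; nothing of that
manuscript is used or asserted here.

## Sources

* J. Kollár, *Lectures on Resolution of Singularities*, Ann. of Math. Stud. 166 (2007), 3.58–3.60
  (birational transform of hypersurfaces under smooth blow-ups of multiplicity `m` centres). [Kollar2007]
* V. Cossart, O. Piltant, J. Algebra 320 (2008) 1051–1082, proof of Prop. 4.2, (10)–(11). [CossartPiltant2008]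
* U. Görtz, T. Wedhorn, *Algebraic Geometry I* (2020), (13.19) (strict transform as a saturation). [GortzWedhorn2020]
-/

noncomputable section

open CategoryTheory CategoryTheory.Limits AlgebraicGeometry TopologicalSpace IsLocalRing

namespace Literature.AlgebraicGeometry.Resolution

universe u

open Scheme.IdealSheafData

/-! ## Pure algebra: `(e^μ g : e^n) = (g)` for `e` prime to `g` -/

section Ring

variable {A : Type*} [CommRing A]

/-- If `e` is a nonzerodivisor such that `e ∣ g t ⇒ e ∣ t`, then `e^m s = g t` forces `s ∈ (g)`.
[folklore] -/
private theorem mem_span_singleton_of_pow_mul_eq {e g : A} (he : e ∈ nonZeroDivisors A)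
    (hprime : ∀ t, e ∣ g * t → e ∣ t) :
    ∀ (m : ℕ) (s t : A), e ^ m * s = g * t → s ∈ Ideal.span {g} := by
  intro m
  induction m with
  | zero =>
    intro s t h
    rw [pow_zero, one_mul] at h
    exact Ideal.mem_span_singleton'.mpr ⟨t, by rw [mul_comm, h]⟩
  | succ m ih =>
    intro s t h
    have hdiv : e ∣ g * t := ⟨e ^ m * s, by rw [← h, pow_succ]; ring⟩
    obtain ⟨t', rfl⟩ := hprime t hdiv
    refine ih s t' ((mul_cancel_left_mem_nonZeroDivisors he).mp ?_)
    calc e * (e ^ m * s) = e ^ (m + 1) * s := by rw [pow_succ]; ring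
      _ = g * (e * t') := h
      _ = e * (g * t') := by ring

/-- **`(e^b g : (e)^n) ⊆ (g)`** for a nonzerodivisor `e` with `e ∣ g t ⇒ e ∣ t`. [folklore] -/
private theorem colon_span_pow_mul_le_span {e g : A} (he : e ∈ nonZeroDivisors A)
    (hprime : ∀ t, e ∣ g * t → e ∣ t) (b n : ℕ) :
    Submodule.colon (Ideal.span {e ^ b * g}) ((Ideal.span {e} ^ n : Ideal A) : Set A) ≤
      Ideal.span {g} := by
  intro s hs
  rw [Submodule.mem_colon] at hs
  have h1 : s * e ^ n ∈ Ideal.span {e ^ b * g} := by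
    have := hs (e ^ n) (by
      rw [Ideal.span_singleton_pow, SetLike.mem_coe]
      exact Ideal.mem_span_singleton_self _)
    simpa [smul_eq_mul] using this
  obtain ⟨t, ht⟩ := Ideal.mem_span_singleton'.mp h1
  rcases le_or_gt n b with hnb | hbn
  · have key : e ^ n * s = e ^ n * (g * (e ^ (b - n) * t)) := by
      calc e ^ n * s = s * e ^ n := mul_comm _ _
        _ = t * (e ^ b * g) := ht.symm
        _ = t * (e ^ (n + (b - n)) * g) := by rw [Nat.add_sub_cancel' hnb]
        _ = e ^ n * (g * (e ^ (b - n) * t)) := by rw [pow_add]; ring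
    have hs' : s = g * (e ^ (b - n) * t) :=
      (mul_cancel_left_mem_nonZeroDivisors (pow_mem he n)).mp key
    exact Ideal.mem_span_singleton'.mpr ⟨e ^ (b - n) * t, by rw [hs']; ring⟩
  · have key : e ^ b * (e ^ (n - b) * s) = e ^ b * (g * t) := by
      calc e ^ b * (e ^ (n - b) * s) = e ^ (b + (n - b)) * s := by rw [pow_add, mul_assoc]
        _ = e ^ n * s := by rw [Nat.add_sub_cancel' hbn.le]
        _ = s * e ^ n := mul_comm _ _
        _ = t * (e ^ b * g) := ht.symm
        _ = e ^ b * (g * t) := by ring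
    exact mem_span_singleton_of_pow_mul_eq he hprime (n - b) s t
      ((mul_cancel_left_mem_nonZeroDivisors (pow_mem he b)).mp key)

/-- `(g) ⊆ (e^b g : (e)^b)`. [folklore] -/
private theorem span_le_colon_span_pow_mul (e g : A) (b : ℕ) :
    Ideal.span {g} ≤
      Submodule.colon (Ideal.span {e ^ b * g}) ((Ideal.span {e} ^ b : Ideal A) : Set A) := by
  intro s hs
  rw [Submodule.mem_colon]
  intro p hp
  rw [Ideal.span_singleton_pow, SetLike.mem_coe] at hp
  obtain ⟨r, rfl⟩ := Ideal.mem_span_singleton'.mp hs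
  obtain ⟨q, rfl⟩ := Ideal.mem_span_singleton'.mp hp
  rw [smul_eq_mul]
  exact Ideal.mem_span_singleton'.mpr ⟨r * q, by ring⟩

/-- In a prime principal ideal `(e) ∌ g`: `e ∣ g t ⇒ e ∣ t`. [folklore] -/
private theorem dvd_of_dvd_mul_of_isPrime_span {e g : A} (hprime : (Ideal.span {e}).IsPrime)
    (hg : g ∉ Ideal.span {e}) (t : A) (h : e ∣ g * t) : e ∣ t := by
  have hmem : g * t ∈ Ideal.span {e} := Ideal.mem_span_singleton.mpr h
  rcases hprime.mem_or_mem hmem with h1 | h2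
  · exact absurd h1 hg
  · exact Ideal.mem_span_singleton.mp h2

/-- Transport of `φ f = t^μ f'` along `χ ∘ φ = ψ`: `ψ(f) S = (χ(t)^μ χ(f'))`. [folklore] -/
private theorem Ideal.map_span_singleton_eq_of_eq_pow_mul {R B S : Type*} [CommRing R] [CommRing B]
    [CommRing S] (φ : R →+* B) (χ : B →+* S) (ψ : R →+* S) (hχ : ∀ a, χ (φ a) = ψ a)
    {t f' : B} {f : R} {μ : ℕ} (hff' : φ f = t ^ μ * f') :
    (Ideal.span {f}).map ψ = Ideal.span {χ t ^ μ * χ f'} := by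
  rw [Ideal.map_span, Set.image_singleton, ← hχ, hff', map_mul, map_pow]

end Ring

/-! ## Stalks of an effective Cartier divisor -/

section Cartier

variable {X : Scheme.{u}}

/-- The stalks of an effective Cartier divisor are generated by nonzerodivisors. [folklore] -/
private theorem IsEffectiveCartier.exists_stalkIdeal_eq_span_of_mem_nonZeroDivisors {K : X.IdealSheafData}
    (hK : IsEffectiveCartier K) (x : X) :
    ∃ t ∈ nonZeroDivisors (X.presheaf.stalk x), stalkIdeal K x = Ideal.span {t} := by
  obtain ⟨U, hxU, f, hf, hKU⟩ := hK x
  letI : Algebra Γ(X, U) (X.presheaf.stalk x) := (X.presheaf.germ U x hxU).hom.toAlgebra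
  haveI : IsLocalization.AtPrime (X.presheaf.stalk x) (U.2.primeIdealOf ⟨x, hxU⟩).asIdeal :=
    U.2.isLocalization_stalk ⟨x, hxU⟩
  refine ⟨(X.presheaf.germ U x hxU).hom f, ?_, ?_⟩
  · exact IsLocalization.nonZeroDivisors_le_comap (U.2.primeIdealOf ⟨x, hxU⟩).asIdeal.primeCompl
      (X.presheaf.stalk x) hf
  · rw [stalkIdeal_eq_map_germ K U hxU, hKU, Ideal.map_span, Set.image_singleton]

/-- **The stalks of an effective Cartier divisor are principal** (the hypothesis `hJ` of
`IsBlowup.strictTransformIdeal_eq_controlledTransform_of_forall_isPrincipal` for the ideal of a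
curve on a regular surface, or of any hypersurface given as an effective Cartier divisor); the
generator may be taken to be a nonzerodivisor (`IsEffectiveCartier.exists_stalkIdeal_eq_span`,
`BlowupChartMembership.lean`): Stacks, Def. 31.14.1 "an effective Cartier divisor is a locally
principal closed subscheme" with Lemma 31.14.2 (2) "`U ∩ D = Spec(A/(f))` with `f ∈ A` a
nonzerodivisor", read in the stalks. [cite: StacksProject, Tag 01WR (Def. 31.14.1); Tag 01WS (Lemma 31.14.2)] -/
theorem isPrincipal_stalkIdeal_of_isEffectiveCartier {K : X.IdealSheafData} (hK : IsEffectiveCartier K)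
    (x : X) : (stalkIdeal K x).IsPrincipal := by
  obtain ⟨t, -, ht⟩ := hK.exists_stalkIdeal_eq_span_of_mem_nonZeroDivisors x
  rw [ht]
  exact ⟨⟨t, rfl⟩⟩

end Cartier

/-! ## The chart computation at a point of the exceptional divisor -/

section Chart

variable {X X' : Scheme.{u}} {π : X' ⟶ X}

/-- If `F̄ ≠ 0` modulo `𝔪` then `F̄ ≠ 0` modulo any smaller ideal. [folklore] -/
private theorem MvPolynomial.map_mk_ne_zero_of_le {R : Type*} [CommRing R] {σ : Type*} {I M : Ideal R}
    (hle : I ≤ M) {F : MvPolynomial σ R}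
    (hF : MvPolynomial.map (Ideal.Quotient.mk M) F ≠ 0) :
    MvPolynomial.map (Ideal.Quotient.mk I) F ≠ 0 := by
  intro h0
  apply hF
  have hfac : Ideal.Quotient.mk M = (Ideal.Quotient.factor hle).comp (Ideal.Quotient.mk I) := by
    ext r; rfl
  rw [hfac, ← MvPolynomial.map_map, h0, map_zero]

set_option maxHeartbeats 400000 in -- one chart-to-stalk unification, as in `RegularCentreBlowupOrder.lean`
/-- **The total transform of a hypersurface of multiplicity `μ` along the centre**: for the
blowing up `π` of the regular locally Noetherian `X` along a regular centre `Y ⊆ {ord_x J = μ}`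
and a point `x'` over `x ∈ Y` at which `J_x` is principal, there are `e, g' ∈ 𝒪_{X',x'}` with
`𝓘_{E,x'} = (e)` (the exceptional divisor), `J_x 𝒪_{X',x'} = (e^μ g')`, `e` a nonzerodivisor
generating a PRIME ideal, and `g' ∉ (e)` (Kollár 3.60: "`π^* X = m E + X'`" with `X'` not
containing `E`; [CoP1] (11): the weak transform `F(e)` of `g = F(c)` is not in `(φ c_j)`).
[cite: Kollar2007, 3.58–3.60] [cite: CossartPiltant2008, proof of Prop. 4.2, (10)–(11)] -/
theorem IsBlowup.exists_stalkIdeal_map_eq_span_pow_mul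
    [IsLocallyNoetherian X] (hX : Scheme.IsRegular X) {Y : Closeds X}
    (hreg : Scheme.IsRegular (vanishingIdeal Y).subscheme) (hπ : IsBlowup π (vanishingIdeal Y))
    {J : X.IdealSheafData} {μ : ℕ} (hY : ∀ y ∈ (Y : Set X), idealOrder J y = μ) {x' : X'}
    (hx : π x' ∈ (Y : Set X)) (hJ : (stalkIdeal J (π x')).IsPrincipal) :
    ∃ e g' : X'.presheaf.stalk x',
      stalkIdeal ((vanishingIdeal Y).comap π) x' = Ideal.span {e} ∧
        (stalkIdeal J (π x')).map (π.stalkMap x').hom = Ideal.span {e ^ μ * g'} ∧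
          e ∈ nonZeroDivisors (X'.presheaf.stalk x') ∧ (Ideal.span {e}).IsPrime ∧
            g' ∉ Ideal.span {e} := by
  classical
  haveI := hX (π x')
  have hxC : π x' ∈ (vanishingIdeal Y).support := by
    rw [← SetLike.mem_coe, coe_support_vanishingIdeal]
    exact hx
  obtain ⟨P, hPdef⟩ : ∃ P : Ideal (X.presheaf.stalk (π x')),
      P = stalkIdeal (vanishingIdeal Y) (π x') := ⟨_, rfl⟩
  have hPle : P ≤ maximalIdeal _ := hPdef ▸ (mem_support_iff_stalkIdeal_le _ (π x')).mp hxC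
  haveI hPq : IsRegularLocalRing (X.presheaf.stalk (π x') ⧸ P) :=
    hPdef ▸ isRegularLocalRing_stalk_quotient_stalkIdeal hreg hxC
  -- quasi-regular generators `c` of `P`, all in `𝔪`
  obtain ⟨k, c, -, hcspan, hcq, -⟩ :=
    exists_isQuasiRegular_span_eq_of_isRegularLocalRing_quotient hPle (P : Set _) (Ideal.span_eq P)
  have hcm : ∀ l, c l ∈ maximalIdeal _ := fun l =>
    hPle (hcspan ▸ Ideal.subset_span ⟨l, rfl⟩)
  -- the chart presentation `𝒪_{X',x'} = (B_j)_𝔴`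
  obtain ⟨j, 𝔴, χ, hχ, hloc, h𝔴⟩ := hπ.exists_reesChart_stalk x' c (hcspan.trans hPdef)
  letI := χ.toAlgebra
  haveI : IsLocalization.AtPrime (X'.presheaf.stalk x') 𝔴.asIdeal := hloc
  -- a generator `g = F(c)` of `J_x` of order exactly `μ`, `F` a form of degree `μ` with `F̄ ≠ 0`
  obtain ⟨g, hg⟩ := (Submodule.isPrincipal_iff _).mp hJ
  have hgJ : g ∈ stalkIdeal J (π x') := by
    rw [hg]
    exact Submodule.mem_span_singleton_self g
  have hord := hY (π x') hx
  have hgm' : g ∉ maximalIdeal _ ^ (μ + 1) := by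
    intro hgm
    have hle : stalkIdeal J (π x') ≤ maximalIdeal _ ^ (μ + 1) := by
      rw [hg]
      exact (Submodule.span_singleton_le_iff_mem _ _).mpr hgm
    rw [← le_idealOrder_iff, hord] at hle
    exact absurd (by exact_mod_cast hle) (Nat.not_succ_le_self μ)
  have hgP : g ∈ Ideal.span (Set.range c) ^ μ := by
    rw [hcspan, hPdef, ← stalkIdeal_pow]
    exact stalkIdeal_mono (le_vanishingIdeal_pow_of_forall_idealOrder_eq hX hreg hY) _ hgJ
  obtain ⟨F, hF, hFg⟩ := exists_isHomogeneous_of_mem_span_pow c μ hgP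
  have hF0 : MvPolynomial.map (Ideal.Quotient.mk (maximalIdeal _)) F ≠ 0 :=
    map_residue_ne_zero_of_eval_not_mem_pow_succ c hcm hF (by rw [hFg]; exact hgm')
  have hF0' : MvPolynomial.map (Ideal.Quotient.mk (Ideal.span (Set.range c))) F ≠ 0 :=
    MvPolynomial.map_mk_ne_zero_of_le (hcspan.trans_le hPle) hF0
  -- the weak transform `F(e)` on the chart is not in the (prime) exceptional ideal `(φ c_j)`
  have hFe : (MvPolynomial.eval₂Hom (chartBase c j) fun l => chartGen c j l) F ∉
      Ideal.span {chartBase c j (c j)} := eval₂Hom_chartGen_not_mem_span c j hcq hF hF0'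
  haveI : IsDomain (X.presheaf.stalk (π x') ⧸ Ideal.span (Set.range c)) := by
    rw [hcspan]
    exact isDomain_of_isRegularLocalRing _
  have hQ : (Ideal.span {chartBase c j (c j)}).IsPrime := isPrime_span_chartBase_self c j hcq
  have hQ𝔴 : Ideal.span {chartBase c j (c j)} ≤ 𝔴.asIdeal := by
    rw [Ideal.span_le, Set.singleton_subset_iff, SetLike.mem_coe, ← Ideal.mem_comap, h𝔴]
    exact hcm j
  have hdisj : Disjoint (𝔴.asIdeal.primeCompl : Set (chartRing c j))
      (Ideal.span {chartBase c j (c j)} : Set (chartRing c j)) := by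
    rw [Set.disjoint_left]
    intro a ha haQ
    exact ha (hQ𝔴 haQ)
  have hmapQ : Ideal.span {χ (chartBase c j (c j))} = (Ideal.span {chartBase c j (c j)}).map χ := by
    rw [Ideal.map_span, Set.image_singleton]
  -- the exceptional stalk is `(e)`, `e = φ(c_j)`
  have hu : ∀ l, (π.stalkMap x').hom (c l) = (π.stalkMap x').hom (c j) * χ (chartGen c j l) :=
    fun l => by rw [← hχ, ← hχ, ← map_mul, ← reesChartBase_apply_eq_mul_chartGen c j l]
  have hE : stalkIdeal ((vanishingIdeal Y).comap π) x' = Ideal.span {χ (chartBase c j (c j))} := by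
    rw [stalkIdeal_comap_eq_map_stalkMap, ← hPdef, ← hcspan,
      Ideal.map_span_range_eq_span_singleton _ c j _ hu, ← hχ]
  refine ⟨χ (chartBase c j (c j)),
    χ ((MvPolynomial.eval₂Hom (chartBase c j) fun l => chartGen c j l) F), hE, ?_, ?_, ?_, ?_⟩
  · -- `J_x 𝒪 = (e^μ g')`
    have hff' := reesChartBase_eval_eq_pow_mul_eval₂ c j hF
    have hg' : stalkIdeal J (π x') = Ideal.span {g} := hg
    rw [hg', ← hFg]
    exact Ideal.map_span_singleton_eq_of_eq_pow_mul (chartBase c j) χ (π.stalkMap x').hom hχ hff'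
  · -- `e` is a nonzerodivisor: the exceptional divisor is Cartier
    obtain ⟨t, ht, hte⟩ :=
      hπ.isEffectiveCartier.exists_stalkIdeal_eq_span_of_mem_nonZeroDivisors x'
    exact mem_nonZeroDivisors_of_span_singleton_eq (hE.symm.trans hte) ht
  · -- `(e)` is prime: the localization of the prime `(φ c_j) ⊆ 𝔴`
    rw [hmapQ]
    exact IsLocalization.isPrime_of_isPrime_disjoint 𝔴.asIdeal.primeCompl (X'.presheaf.stalk x') _
      hQ hdisj
  · -- `g' ∉ (e)`: `(φ c_j) B_𝔴 ∩ B_j = (φ c_j)`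
    intro hmem
    apply hFe
    rw [hmapQ] at hmem
    have hunder := IsLocalization.under_map_of_isPrime_disjoint 𝔴.asIdeal.primeCompl
      (X'.presheaf.stalk x') hQ hdisj
    rw [← hunder]
    exact Ideal.mem_comap.mpr hmem

/-! ## Stalks of the weak and of the strict transform -/

/-- **The weak transform of a hypersurface of multiplicity `μ` along the centre has stalk `(g')`**
at a point `x'` over the centre: `(J𝒪_{X'} : 𝓘_E^μ)_{x'} = (e^μ g' : e^μ) = (g')`, and the strict
transform `⋃ₙ (J𝒪_{X'} : 𝓘_E^n)_{x'}` is the same ideal (`e` being prime to `g'`).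
[cite: Kollar2007, 3.58–3.60] -/
theorem IsBlowup.stalkIdeal_transforms_eq_span_of_isPrincipal
    [IsLocallyNoetherian X] [IsLocallyNoetherian X'] (hX : Scheme.IsRegular X) {Y : Closeds X}
    (hreg : Scheme.IsRegular (vanishingIdeal Y).subscheme) (hπ : IsBlowup π (vanishingIdeal Y))
    {J : X.IdealSheafData} {μ : ℕ} (hY : ∀ y ∈ (Y : Set X), idealOrder J y = μ) {x' : X'}
    (hx : π x' ∈ (Y : Set X)) (hJ : (stalkIdeal J (π x')).IsPrincipal) :
    ∃ g' : X'.presheaf.stalk x',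
      stalkIdeal (controlledTransform π (vanishingIdeal Y) J μ) x' = Ideal.span {g'} ∧
        stalkIdeal (strictTransformIdeal π (vanishingIdeal Y) J) x' = Ideal.span {g'} := by
  obtain ⟨e, g', hE, hmap, he, hprime, hg'⟩ :=
    hπ.exists_stalkIdeal_map_eq_span_pow_mul hX hreg hY hx hJ
  have hdvd := dvd_of_dvd_mul_of_isPrime_span hprime hg'
  have hctrl : stalkIdeal (controlledTransform π (vanishingIdeal Y) J μ) x' =
      Submodule.colon (Ideal.span {e ^ μ * g'}) ((Ideal.span {e} ^ μ : Ideal _) : Set _) := by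
    rw [controlledTransform, stalkIdeal_colon, stalkIdeal_pow, stalkIdeal_comap_eq_map_stalkMap π J,
      hmap, hE]
  have hstrict : stalkIdeal (strictTransformIdeal π (vanishingIdeal Y) J) x' =
      ⨆ n : ℕ, Submodule.colon (Ideal.span {e ^ μ * g'}) ((Ideal.span {e} ^ n : Ideal _) : Set _) := by
    rw [stalkIdeal_strictTransformIdeal, hmap, hE]
  have h1 : stalkIdeal (strictTransformIdeal π (vanishingIdeal Y) J) x' ≤ Ideal.span {g'} := by
    rw [hstrict]
    exact iSup_le fun n => colon_span_pow_mul_le_span he hdvd μ n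
  have h2 : Ideal.span {g'} ≤ stalkIdeal (controlledTransform π (vanishingIdeal Y) J μ) x' := by
    rw [hctrl]
    exact span_le_colon_span_pow_mul e g' μ
  have h3 : stalkIdeal (controlledTransform π (vanishingIdeal Y) J μ) x' ≤
      stalkIdeal (strictTransformIdeal π (vanishingIdeal Y) J) x' :=
    stalkIdeal_mono (controlledTransform_le_strictTransformIdeal π _ J μ) x'
  exact ⟨g', le_antisymm (h3.trans h1) h2, le_antisymm h1 (h2.trans h3)⟩

/-- **Off the centre**: the stalks of the strict and of every weak transform are the pulled-back
stalk `J_{π x'} 𝒪_{X',x'}`. [folklore] -/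
private theorem stalkIdeal_strictTransformIdeal_eq_stalkIdeal_controlledTransform_of_not_mem
    [IsLocallyNoetherian X'] {Y : Closeds X} (J : X.IdealSheafData) (μ : ℕ) {x' : X'}
    (hx : π x' ∉ (Y : Set X)) :
    stalkIdeal (strictTransformIdeal π (vanishingIdeal Y) J) x' =
      stalkIdeal (controlledTransform π (vanishingIdeal Y) J μ) x' := by
  have hxC : π x' ∉ (vanishingIdeal Y).support := by
    rwa [← SetLike.mem_coe, coe_support_vanishingIdeal]
  have hxC' : x' ∉ ((vanishingIdeal Y).comap π).support := by
    rwa [Scheme.IdealSheafData.support_comap]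
  rw [stalkIdeal_strictTransformIdeal_of_not_mem π _ J hxC',
    stalkIdeal_controlledTransform_of_not_mem_support J μ hxC]

/-! ## Sheaf level -/

/-- **Strict transform = weak transform with the maximal exponent, for hypersurfaces.** Let `π` be
the blowing up of the regular locally Noetherian `X` along a regular centre `Y ⊆ {ord_x J = μ}`,
with `J` a hypersurface (every stalk `J_x` principal). Then the scheme-theoretic strict transform
`⋃ₙ (J𝒪_{X'} : 𝓘_Eⁿ)` of `V(J)` equals the weak (controlled) transform `(J𝒪_{X'} : 𝓘_E^μ)`
(Kollár 3.60: `π^*X = m·E + π_*^{-1} X` when `mult_Z X = m`). [cite: Kollar2007, 3.58–3.60] -/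
theorem IsBlowup.strictTransformIdeal_eq_controlledTransform_of_forall_isPrincipal
    [IsLocallyNoetherian X] [IsLocallyNoetherian X'] (hX : Scheme.IsRegular X) {Y : Closeds X}
    (hreg : Scheme.IsRegular (vanishingIdeal Y).subscheme) (hπ : IsBlowup π (vanishingIdeal Y))
    {J : X.IdealSheafData} {μ : ℕ} (hY : ∀ y ∈ (Y : Set X), idealOrder J y = μ)
    (hJ : ∀ x, (stalkIdeal J x).IsPrincipal) :
    strictTransformIdeal π (vanishingIdeal Y) J = controlledTransform π (vanishingIdeal Y) J μ := by
  refine le_antisymm (le_of_forall_stalkIdeal_le fun x' => ?_)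
    (controlledTransform_le_strictTransformIdeal π _ J μ)
  by_cases hx : π x' ∈ (Y : Set X)
  · obtain ⟨g', h1, h2⟩ := hπ.stalkIdeal_transforms_eq_span_of_isPrincipal hX hreg hY hx (hJ _)
    rw [h1, h2]
  · rw [stalkIdeal_strictTransformIdeal_eq_stalkIdeal_controlledTransform_of_not_mem J μ hx]

/-- **The weak transform of a hypersurface along a centre of multiplicity `μ` is a hypersurface**:
every stalk of `(J𝒪_{X'} : 𝓘_E^μ)` is principal (`(g')` over the centre, `J_{π x'}𝒪_{X',x'}`
elsewhere). [cite: Kollar2007, 3.58–3.60] -/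
theorem IsBlowup.isPrincipal_stalkIdeal_controlledTransform
    [IsLocallyNoetherian X] [IsLocallyNoetherian X'] (hX : Scheme.IsRegular X) {Y : Closeds X}
    (hreg : Scheme.IsRegular (vanishingIdeal Y).subscheme) (hπ : IsBlowup π (vanishingIdeal Y))
    {J : X.IdealSheafData} {μ : ℕ} (hY : ∀ y ∈ (Y : Set X), idealOrder J y = μ)
    (hJ : ∀ x, (stalkIdeal J x).IsPrincipal) (x' : X') :
    (stalkIdeal (controlledTransform π (vanishingIdeal Y) J μ) x').IsPrincipal := by
  by_cases hx : π x' ∈ (Y : Set X)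
  · obtain ⟨g', h1, -⟩ := hπ.stalkIdeal_transforms_eq_span_of_isPrincipal hX hreg hY hx (hJ _)
    rw [h1]
    exact ⟨⟨g', rfl⟩⟩
  · have hxC : π x' ∉ (vanishingIdeal Y).support := by
      rwa [← SetLike.mem_coe, coe_support_vanishingIdeal]
    rw [stalkIdeal_controlledTransform_of_not_mem_support J μ hxC]
    obtain ⟨g, hg⟩ := (Submodule.isPrincipal_iff _).mp (hJ (π x'))
    have hg' : stalkIdeal J (π x') = Ideal.span {g} := hg
    rw [hg', Ideal.map_span, Set.image_singleton]
    exact ⟨⟨_, rfl⟩⟩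

/-- **`π^*X = m·E + X'` (Kollár 3.60) as an identity of ideal sheaves**: for the blowing up `π` of
the regular locally Noetherian `X` along a regular centre `Y ⊆ {ord_x J = μ}` and a hypersurface
`J` (every stalk principal), the total transform is the `μ`-th power of the exceptional ideal
times the strict transform, `J𝒪_{X'} = 𝓘_E^μ · ⋃ₙ (J𝒪_{X'} : 𝓘_Eⁿ)` — the two identities
`𝓘_E^μ · (J𝒪_{X'} : 𝓘_E^μ) = J𝒪_{X'}` (`IsBlowup.pow_mul_controlledTransform_eq_of_forall_idealOrder_eq`)
and strict = weak transform with exponent `μ` (`IsBlowup.strictTransformIdeal_eq_controlledTransform_of_forall_isPrincipal`)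
combined. For `Y` a closed point `q` of a regular surface and `J` the ideal of a curve `Γ` with
`mult_q Γ = μ` this is `π^*Γ = Γ̃ + μ·C` (Liu, Prop. 9.2.23; the centre `{q}` is regular by
`isRegular_subscheme_vanishingIdeal_singleton` of `PointCentrePermissible.lean`).
[cite: Kollar2007, 3.58–3.60] -/
theorem IsBlowup.comap_eq_pow_mul_strictTransformIdeal_of_forall_isPrincipal
    [IsLocallyNoetherian X] [IsLocallyNoetherian X'] (hX : Scheme.IsRegular X) {Y : Closeds X}
    (hreg : Scheme.IsRegular (vanishingIdeal Y).subscheme) (hπ : IsBlowup π (vanishingIdeal Y))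
    {J : X.IdealSheafData} {μ : ℕ} (hY : ∀ y ∈ (Y : Set X), idealOrder J y = μ)
    (hJ : ∀ x, (stalkIdeal J x).IsPrincipal) :
    J.comap π = (vanishingIdeal Y).comap π ^ μ * strictTransformIdeal π (vanishingIdeal Y) J := by
  rw [hπ.strictTransformIdeal_eq_controlledTransform_of_forall_isPrincipal hX hreg hY hJ,
    hπ.pow_mul_controlledTransform_eq_of_forall_idealOrder_eq hX hreg hY]

end Chart

end Literature.AlgebraicGeometry.Resolution

end
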